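import Mathlib
import Literature.Computability.AlgebraicComplexity.PermanentIrreducible
import Literature.Computability.AlgebraicComplexity.BLMW11PerOrbitCeiling
import Summits.ValiantsHypothesis.ValiantsHypothesis.Theorems.PolyaContinuedStrengthTwoPerFourRowWeight

/-!
# `str₂(per₄) = 6` on the ROW-SPLIT and COLUMN-SPLIT strata (I3's «System B» is infeasible exactly)
# (support item `StrengthTwoPerFour`, stmt-ValiantsHypothesis-25160, route `PolyaContinued` — helper, special cases)

Special cases of the item `StrengthTwoPerFour` («the `4 × 4` permanent is not a sum of FIVE products `pᵢ qᵢ` of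
quadrics») drawn from the Laplace-weight inequality `laplaceWeight_le_of_perPoly_eq_sum` of the companion file
`…PolyaContinuedStrengthTwoPerFourRowWeight.lean` (itself a corollary of the tensor theorem `laplaceOptimal_four`).
Notation as there: `g_R(v) = Σ_{j∈R} e_{(j, v j)}` is the row-graph exponent (monomial `Π_{j∈R} x_{j, v(j)}`).

* `perPoly_ne_sum_of_rookRows`: if the GRAPH-TYPE monomials of every `pᵢ` (those dividing some `Π_j x_{j,v(j)}`)
  lie on ONE row pair `{rᵢ, sᵢ}` — its squares, same-row products and the `qᵢ` being unrestricted — then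
  `per₄ ≠ Σ_{i<N} pᵢ qᵢ` for `N < 6` (weight `4N < 24`).
* `perPoly_ne_sum_of_rowSplit` (+ `_right`, `_or`): every `pᵢ` (or every `qᵢ`, or for each `i` one of the two)
  ROW-SPLIT-homogeneous — all monomials `x_{rᵢ a} · x_{sᵢ b}`, i.e. bilinear in the rows `rᵢ ≠ sᵢ`.  This is the
  numerical instrument I3's «System B» of the cell `val-width` (2|2-partition / row-split decompositions of `per₄`,
  1 452 width-five starts, no honest point — `I3-RUNG1-MEMO`, evidence on the item), now infeasible EXACTLY and
  with the second factors arbitrary.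
* Column versions by the transpose symmetry `per(Xᵀ) = per(X)` (`rename_swap_perPoly_fin`):
  `exists_two_active_colSets`, `perPoly_ne_sum_of_rookCols`, `perPoly_ne_sum_of_colSplit`.
* The literal body of the route statement `Theses.PolyaContinued.StrengthTwoPerFour` on these strata:
  `strengthTwoPerFour_rowSplit`, `_rowSplit_right`, `_rookRows`, `_colSplit` (five-term families; the
  homogeneity conjuncts of the item are not even needed).

HONEST FRAMING.  SPECIAL CASES of stmt-25160 (filed `--supports`; the item is neither closed nor claimed).
`StrengthTwoPerFour` stays OPEN/GATED (`4 ≤ str₂(per₄) ≤ 6`, border `≤ 5` by `laplaceOptimal_four_border`);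
nothing here bears on `VP ≠ VNP`.
-/

set_option autoImplicit false

-- the mandated summit-side namespace repeats a component by design (single-problem summit)
set_option linter.dupNamespace false

namespace Summit.ValiantsHypothesis.ValiantsHypothesis.Theorems.PolyaContinuedLaplaceRigidity.RowWeight

open MvPolynomial Literature.Computability.AlgebraicComplexity

/-! ### §4 Graph-type monomials on one row pair; the row-split stratum (I3's System B) -/

/-- **No width-`< 6` identity when the graph-type monomials of every `pᵢ` lie on one row pair.**  If for every
`i` all monomials of `pᵢ` that divide a graph monomial lie on the rows `{r i, s i}` — i.e. `coeff_{pᵢ}(g_R v) = 0`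
for every row set `R ≠ {r i, s i}` — then `per₄ ≠ Σ_{i<N} pᵢ qᵢ` for `N < 6`, whatever the `qᵢ` and whatever the
other (square / same-row) monomials of the `pᵢ`. -/
theorem perPoly_ne_sum_of_rookRows (N : ℕ) (hN : N < 6) (p q : Fin N → MvPolynomial (Fin 4 × Fin 4) ℂ)
    (r s : Fin N → Fin 4) (hrs : ∀ i, r i ≠ s i)
    (hp : ∀ i, ∀ R : Finset (Fin 4), R ≠ {r i, s i} →
      ∀ v : Fin 4 → Fin 4, coeff (∑ j ∈ R, Finsupp.single (j, v j) (1 : ℕ)) (p i) = 0) :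
    perPoly (Fin 4) ℂ ≠ ∑ i, p i * q i := by
  refine perPoly_ne_sum_of_weight_lt N p q (fun i => {{r i, s i}}) (fun i R hR => Or.inl ?_) ?_
  · exact hp i R (by simpa using hR)
  · have hc : ∀ i, ({r i, s i} : Finset (Fin 4)).card = 2 := fun i => Finset.card_pair (hrs i)
    simp only [Finset.sum_singleton, hc, Finset.sum_const, Finset.card_univ, Fintype.card_fin, smul_eq_mul,
      Nat.factorial]
    omega

/-- A row-pair exponent `e_{(ρ,a)} + e_{(ρ',b)}` that is a row-graph exponent `g_R(v)` has `R = {ρ, ρ'}`. -/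
theorem rowSet_eq_pair_of_rowGraph_eq {R : Finset (Fin 4)} {v : Fin 4 → Fin 4} {ρ ρ' a b : Fin 4}
    (h : (∑ j ∈ R, Finsupp.single (j, v j) (1 : ℕ)) = Finsupp.single (ρ, a) 1 + Finsupp.single (ρ', b) 1) :
    R = {ρ, ρ'} := by
  have hval : ∀ σ c : Fin 4, (if σ ∈ R ∧ v σ = c then 1 else 0) =
      (Finsupp.single (ρ, a) (1 : ℕ)) (σ, c) + (Finsupp.single (ρ', b) (1 : ℕ)) (σ, c) := by
    intro σ c
    rw [← rowGraph_apply R v σ c, h, Finsupp.add_apply]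
  ext σ
  simp only [Finset.mem_insert, Finset.mem_singleton]
  constructor
  · intro hσ
    have h1 := hval σ (v σ)
    rw [if_pos ⟨hσ, rfl⟩] at h1
    by_contra hne
    push Not at hne
    have e1 : (Finsupp.single (ρ, a) (1 : ℕ)) (σ, v σ) = 0 :=
      Finsupp.single_eq_of_ne (fun h' => hne.1 (Prod.mk.inj h').1)
    have e2 : (Finsupp.single (ρ', b) (1 : ℕ)) (σ, v σ) = 0 :=
      Finsupp.single_eq_of_ne (fun h' => hne.2 (Prod.mk.inj h').1)
    omega
  · rintro (rfl | rfl)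
    · have h1 := hval σ a
      rw [Finsupp.single_eq_same] at h1
      by_contra hσ
      rw [if_neg (fun h' => hσ h'.1)] at h1
      omega
    · have h1 := hval σ b
      rw [Finsupp.single_eq_same] at h1
      by_contra hσ
      rw [if_neg (fun h' => hσ h'.1)] at h1
      omega

/-- **I3's System B is infeasible exactly (ROW-SPLIT first factors).**  If `N < 6` and every `pᵢ` is
row-split-homogeneous (all its monomials are `x_{r i, a} · x_{s i, b}` for fixed rows `r i ≠ s i`), then
`per₄ ≠ Σ_{i<N} pᵢ qᵢ`, whatever the `qᵢ`. -/
theorem perPoly_ne_sum_of_rowSplit (N : ℕ) (hN : N < 6) (p q : Fin N → MvPolynomial (Fin 4 × Fin 4) ℂ)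
    (r s : Fin N → Fin 4) (hrs : ∀ i, r i ≠ s i)
    (hp : ∀ i, ∀ d ∈ (p i).support, ∃ a b : Fin 4, d = Finsupp.single (r i, a) 1 + Finsupp.single (s i, b) 1) :
    perPoly (Fin 4) ℂ ≠ ∑ i, p i * q i := by
  refine perPoly_ne_sum_of_rookRows N hN p q r s hrs fun i R hR v => ?_
  by_contra hc
  obtain ⟨a, b, hab⟩ := hp i _ (mem_support_iff.2 hc)
  exact hR (rowSet_eq_pair_of_rowGraph_eq hab)

/-- The same with the SECOND factors row-split-homogeneous and the first factors arbitrary. -/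
theorem perPoly_ne_sum_of_rowSplit_right (N : ℕ) (hN : N < 6) (p q : Fin N → MvPolynomial (Fin 4 × Fin 4) ℂ)
    (r s : Fin N → Fin 4) (hrs : ∀ i, r i ≠ s i)
    (hq : ∀ i, ∀ d ∈ (q i).support, ∃ a b : Fin 4, d = Finsupp.single (r i, a) 1 + Finsupp.single (s i, b) 1) :
    perPoly (Fin 4) ℂ ≠ ∑ i, p i * q i := by
  intro hper
  refine perPoly_ne_sum_of_rowSplit N hN q p r s hrs hq ?_
  rw [hper]
  exact Finset.sum_congr rfl fun i _ => mul_comm _ _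

/-- MIXED FORM: for each `i`, ONE of the two factors `pᵢ`, `qᵢ` is row-split-homogeneous (the row pair may
depend on `i`).  Then `per₄ ≠ Σ_{i<N} pᵢ qᵢ` for `N < 6`. -/
theorem perPoly_ne_sum_of_rowSplit_or (N : ℕ) (hN : N < 6) (p q : Fin N → MvPolynomial (Fin 4 × Fin 4) ℂ)
    (h : ∀ i, ∃ ρ ρ' : Fin 4, ρ ≠ ρ' ∧
      ((∀ d ∈ (p i).support, ∃ a b : Fin 4, d = Finsupp.single (ρ, a) 1 + Finsupp.single (ρ', b) 1) ∨
       (∀ d ∈ (q i).support, ∃ a b : Fin 4, d = Finsupp.single (ρ, a) 1 + Finsupp.single (ρ', b) 1))) :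
    perPoly (Fin 4) ℂ ≠ ∑ i, p i * q i := by
  classical
  choose r s hrs hsplit using h
  -- put the split factor first
  let p' : Fin N → MvPolynomial (Fin 4 × Fin 4) ℂ := fun i =>
    if (∀ d ∈ (p i).support, ∃ a b : Fin 4, d = Finsupp.single (r i, a) 1 + Finsupp.single (s i, b) 1)
    then p i else q i
  let q' : Fin N → MvPolynomial (Fin 4 × Fin 4) ℂ := fun i =>
    if (∀ d ∈ (p i).support, ∃ a b : Fin 4, d = Finsupp.single (r i, a) 1 + Finsupp.single (s i, b) 1)
    then q i else p i
  have hp' : ∀ i, ∀ d ∈ (p' i).support, ∃ a b : Fin 4,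
      d = Finsupp.single (r i, a) 1 + Finsupp.single (s i, b) 1 := by
    intro i
    by_cases hc : ∀ d ∈ (p i).support, ∃ a b : Fin 4, d = Finsupp.single (r i, a) 1 + Finsupp.single (s i, b) 1
    · simp only [p', if_pos hc]; exact hc
    · simp only [p', if_neg hc]; exact (hsplit i).resolve_left hc
  have hprod : ∀ i, p' i * q' i = p i * q i := by
    intro i
    by_cases hc : ∀ d ∈ (p i).support, ∃ a b : Fin 4, d = Finsupp.single (r i, a) 1 + Finsupp.single (s i, b) 1
    · simp only [p', q', if_pos hc]
    · simp only [p', q', if_neg hc]; exact mul_comm _ _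
  intro hper
  refine perPoly_ne_sum_of_rowSplit N hN p' q' r s hrs hp' ?_
  rw [hper]
  exact Finset.sum_congr rfl fun i _ => (hprod i).symm

/-- **The route statement on the row-split stratum.**  The literal body of
`Theses.PolyaContinued.StrengthTwoPerFour` (stmt-ValiantsHypothesis-25160) holds for every pair `(p, q)` of
five-term families whose first factors are row-split-homogeneous (the homogeneity conjuncts are not needed). -/
theorem strengthTwoPerFour_rowSplit (p q : Fin 5 → MvPolynomial (Fin 4 × Fin 4) ℂ)
    (r s : Fin 5 → Fin 4) (hrs : ∀ i, r i ≠ s i)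
    (hp : ∀ i, ∀ d ∈ (p i).support, ∃ a b : Fin 4, d = Finsupp.single (r i, a) 1 + Finsupp.single (s i, b) 1) :
    ¬ ((∀ i, (p i).IsHomogeneous 2) ∧ (∀ i, (q i).IsHomogeneous 2) ∧
        perPoly (Fin 4) ℂ = ∑ i, p i * q i) :=
  fun h => perPoly_ne_sum_of_rowSplit 5 (by norm_num) p q r s hrs hp h.2.2

/-- The route statement on the stratum where the SECOND factors are row-split-homogeneous. -/
theorem strengthTwoPerFour_rowSplit_right (p q : Fin 5 → MvPolynomial (Fin 4 × Fin 4) ℂ)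
    (r s : Fin 5 → Fin 4) (hrs : ∀ i, r i ≠ s i)
    (hq : ∀ i, ∀ d ∈ (q i).support, ∃ a b : Fin 4, d = Finsupp.single (r i, a) 1 + Finsupp.single (s i, b) 1) :
    ¬ ((∀ i, (p i).IsHomogeneous 2) ∧ (∀ i, (q i).IsHomogeneous 2) ∧
        perPoly (Fin 4) ℂ = ∑ i, p i * q i) :=
  fun h => perPoly_ne_sum_of_rowSplit_right 5 (by norm_num) p q r s hrs hq h.2.2

/-- The route statement on the stratum where the graph-type monomials of every first factor lie on one row
pair (other monomials of the `pᵢ` and the `qᵢ` unrestricted beyond the item's homogeneity). -/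
theorem strengthTwoPerFour_rookRows (p q : Fin 5 → MvPolynomial (Fin 4 × Fin 4) ℂ)
    (r s : Fin 5 → Fin 4) (hrs : ∀ i, r i ≠ s i)
    (hp : ∀ i, ∀ R : Finset (Fin 4), R ≠ {r i, s i} →
      ∀ v : Fin 4 → Fin 4, coeff (∑ j ∈ R, Finsupp.single (j, v j) (1 : ℕ)) (p i) = 0) :
    ¬ ((∀ i, (p i).IsHomogeneous 2) ∧ (∀ i, (q i).IsHomogeneous 2) ∧
        perPoly (Fin 4) ℂ = ∑ i, p i * q i) :=
  fun h => perPoly_ne_sum_of_rookRows 5 (by norm_num) p q r s hrs hp h.2.2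

/-! ### §5 Columns (transpose symmetry `per(Xᵀ) = per(X)`) -/

/-- Coefficients of the transposed polynomial: the coefficient of the row-graph exponent `g_R(v)` in
`rename Prod.swap p` is the coefficient of the COLUMN-graph exponent `Σ_{c ∈ R} e_{(v c, c)}` in `p`. -/
theorem coeff_rowGraph_rename_swap (p : MvPolynomial (Fin 4 × Fin 4) ℂ) (R : Finset (Fin 4)) (v : Fin 4 → Fin 4) :
    coeff (∑ j ∈ R, Finsupp.single (j, v j) (1 : ℕ)) (rename (Prod.swap : Fin 4 × Fin 4 → Fin 4 × Fin 4) p) =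
      coeff (∑ c ∈ R, Finsupp.single (v c, c) (1 : ℕ)) p := by
  have h : (∑ j ∈ R, Finsupp.single (j, v j) (1 : ℕ)) =
      Finsupp.mapDomain (Prod.swap : Fin 4 × Fin 4 → Fin 4 × Fin 4) (∑ c ∈ R, Finsupp.single (v c, c) (1 : ℕ)) := by
    rw [Finsupp.mapDomain_finsetSum]
    simp [Finsupp.mapDomain_single]
  rw [h, coeff_rename_mapDomain _ Prod.swap_injective]

/-- An identity `per₄ = Σ pᵢ qᵢ` transposes to `per₄ = Σ pᵢᵀ qᵢᵀ`. -/
theorem perPoly_eq_sum_rename_swap {N : ℕ} {p q : Fin N → MvPolynomial (Fin 4 × Fin 4) ℂ}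
    (hper : perPoly (Fin 4) ℂ = ∑ i, p i * q i) :
    perPoly (Fin 4) ℂ = ∑ i, rename (Prod.swap : Fin 4 × Fin 4 → Fin 4 × Fin 4) (p i) *
      rename (Prod.swap : Fin 4 × Fin 4 → Fin 4 × Fin 4) (q i) := by
  have h := congrArg (rename (Prod.swap : Fin 4 × Fin 4 → Fin 4 × Fin 4)) hper
  rw [rename_swap_perPoly_fin ℂ 4, map_sum] at h
  simpa [map_mul] using h

/-- **Column version of `exists_two_active_rowSets`.**  If the `pᵢ` (`N < 6`) are quadrics and
`per₄ = Σᵢ pᵢ qᵢ`, some product is active on two different COLUMN sets `C ≠ C'`: `pᵢ` has monomials of both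
shapes `Π_{c∈C} x_{w(c), c}`, `Π_{c ∈ C'} x_{w(c), c}` and `qᵢ` of both complementary shapes. -/
theorem exists_two_active_colSets (N : ℕ) (hN : N < 6) (p q : Fin N → MvPolynomial (Fin 4 × Fin 4) ℂ)
    (hp : ∀ i, (p i).IsHomogeneous 2)
    (hper : perPoly (Fin 4) ℂ = ∑ i, p i * q i) :
    ∃ i, ∃ C C' : Finset (Fin 4), C ≠ C' ∧
      (∃ w : Fin 4 → Fin 4, coeff (∑ c ∈ C, Finsupp.single (w c, c) (1 : ℕ)) (p i) ≠ 0) ∧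
      (∃ w : Fin 4 → Fin 4, coeff (∑ c ∈ Cᶜ, Finsupp.single (w c, c) (1 : ℕ)) (q i) ≠ 0) ∧
      (∃ w : Fin 4 → Fin 4, coeff (∑ c ∈ C', Finsupp.single (w c, c) (1 : ℕ)) (p i) ≠ 0) ∧
      (∃ w : Fin 4 → Fin 4, coeff (∑ c ∈ C'ᶜ, Finsupp.single (w c, c) (1 : ℕ)) (q i) ≠ 0) := by
  obtain ⟨i, R, R', hRR', ⟨v₁, h₁⟩, ⟨v₂, h₂⟩, ⟨v₃, h₃⟩, ⟨v₄, h₄⟩⟩ :=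
    exists_two_active_rowSets N hN (fun i => rename Prod.swap (p i)) (fun i => rename Prod.swap (q i))
      (fun i => (hp i).rename_isHomogeneous) (perPoly_eq_sum_rename_swap hper)
  refine ⟨i, R, R', hRR', ⟨v₁, ?_⟩, ⟨v₂, ?_⟩, ⟨v₃, ?_⟩, ⟨v₄, ?_⟩⟩
  · rwa [coeff_rowGraph_rename_swap] at h₁
  · rwa [coeff_rowGraph_rename_swap] at h₂
  · rwa [coeff_rowGraph_rename_swap] at h₃
  · rwa [coeff_rowGraph_rename_swap] at h₄

/-- **Column version of `perPoly_ne_sum_of_rookRows`.**  If the graph-type monomials of every `pᵢ` lie on ONE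
column pair `{a i, b i}` (`coeff_{pᵢ}(Π_{c∈C} x_{w(c),c}) = 0` for every column set `C ≠ {a i, b i}`), then
`per₄ ≠ Σ_{i<N} pᵢ qᵢ` for `N < 6`, whatever the `qᵢ`. -/
theorem perPoly_ne_sum_of_rookCols (N : ℕ) (hN : N < 6) (p q : Fin N → MvPolynomial (Fin 4 × Fin 4) ℂ)
    (a b : Fin N → Fin 4) (hab : ∀ i, a i ≠ b i)
    (hp : ∀ i, ∀ C : Finset (Fin 4), C ≠ {a i, b i} →
      ∀ w : Fin 4 → Fin 4, coeff (∑ c ∈ C, Finsupp.single (w c, c) (1 : ℕ)) (p i) = 0) :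
    perPoly (Fin 4) ℂ ≠ ∑ i, p i * q i := by
  intro hper
  refine perPoly_ne_sum_of_rookRows N hN (fun i => rename Prod.swap (p i)) (fun i => rename Prod.swap (q i))
    a b hab (fun i R hR v => ?_) (perPoly_eq_sum_rename_swap hper)
  rw [coeff_rowGraph_rename_swap]
  exact hp i R hR v

/-- **Column version of `perPoly_ne_sum_of_rowSplit`.**  If every `pᵢ` is COLUMN-split-homogeneous (all its
monomials are `x_{ρ, a i} · x_{ρ', b i}` for fixed columns `a i ≠ b i`), then `per₄ ≠ Σ_{i<N} pᵢ qᵢ` for `N < 6`,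
whatever the `qᵢ`. -/
theorem perPoly_ne_sum_of_colSplit (N : ℕ) (hN : N < 6) (p q : Fin N → MvPolynomial (Fin 4 × Fin 4) ℂ)
    (a b : Fin N → Fin 4) (hab : ∀ i, a i ≠ b i)
    (hp : ∀ i, ∀ d ∈ (p i).support, ∃ ρ ρ' : Fin 4,
      d = Finsupp.single (ρ, a i) 1 + Finsupp.single (ρ', b i) 1) :
    perPoly (Fin 4) ℂ ≠ ∑ i, p i * q i := by
  intro hper
  refine perPoly_ne_sum_of_rowSplit N hN (fun i => rename Prod.swap (p i)) (fun i => rename Prod.swap (q i))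
    a b hab (fun i d hd => ?_) (perPoly_eq_sum_rename_swap hper)
  -- `d` is in the support of `pᵢᵀ`, so `d ∘ swap` is in the support of `pᵢ`
  have hd' : coeff d (rename (Prod.swap : Fin 4 × Fin 4 → Fin 4 × Fin 4) (p i)) ≠ 0 := mem_support_iff.1 hd
  have hmap : d = Finsupp.mapDomain (Prod.swap : Fin 4 × Fin 4 → Fin 4 × Fin 4)
      (Finsupp.mapDomain (Prod.swap : Fin 4 × Fin 4 → Fin 4 × Fin 4) d) := by
    rw [← Finsupp.mapDomain_comp]
    simp [Prod.swap_swap_eq, Finsupp.mapDomain_id]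
  rw [hmap, coeff_rename_mapDomain _ Prod.swap_injective] at hd'
  obtain ⟨ρ, ρ', hρ⟩ := hp i _ (mem_support_iff.2 hd')
  refine ⟨ρ, ρ', ?_⟩
  rw [hmap, hρ]
  simp [Finsupp.mapDomain_add, Finsupp.mapDomain_single]

/-- The route statement on the COLUMN-split stratum. -/
theorem strengthTwoPerFour_colSplit (p q : Fin 5 → MvPolynomial (Fin 4 × Fin 4) ℂ)
    (a b : Fin 5 → Fin 4) (hab : ∀ i, a i ≠ b i)
    (hp : ∀ i, ∀ d ∈ (p i).support, ∃ ρ ρ' : Fin 4,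
      d = Finsupp.single (ρ, a i) 1 + Finsupp.single (ρ', b i) 1) :
    ¬ ((∀ i, (p i).IsHomogeneous 2) ∧ (∀ i, (q i).IsHomogeneous 2) ∧
        perPoly (Fin 4) ℂ = ∑ i, p i * q i) :=
  fun h => perPoly_ne_sum_of_colSplit 5 (by norm_num) p q a b hab hp h.2.2

end Summit.ValiantsHypothesis.ValiantsHypothesis.Theorems.PolyaContinuedLaplaceRigidity.RowWeight
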